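import Summits.ResolutionOfSingularities.ResolutionOfSingularities.Theorems.HomologicalConductorNoZenoExcDegreeOnePoint
import Summits.ResolutionOfSingularities.ResolutionOfSingularities.Theorems.HomologicalConductorNoZenoH0LeResidueDegree
import Summits.ResolutionOfSingularities.ResolutionOfSingularities.Theorems.HomologicalConductorNoZenoIncidenceGraphAcyclic
import Literature.AlgebraicGeometry.Resolution.Lipman1969IntersectionTheory
import Literature.AlgebraicGeometry.Resolution.ExceptionalCurvePoints
import HarnessLib

/-!
# Crux `NoZenoR` (stmt-ResolutionOfSingularities-19943), slot 5 (B1), (P3): TRANSVERSALITY of the exceptional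
# curves of a resolution of a RATIONAL surface singularity — two distinct curves meet in at most one point,
# there with multiplicity one, and both are REGULAR at that point

OURS (cell res-hironaka, crux chain W4.4, seat res-D-pv-045 gen 8; object (P3) of res-L0-w44-plan-1 DESK WORD 19,
2026-08-27T20:32:58Z, the regularity input of the (A4) loop / of `h0_sq_le_h0_sq_strictTransform` p565927); nothing
here is a statement of the manuscript under review (Hironaka 2017); AI-written, weaker than expert review.
SUPPORT-level, counted 0.  Def-free.  ONE fact binder: `(h131d : Lipman1969_13_1_d_rat.{0})` (F-97 d)).

THE ARGUMENT (Lipman's `p_a`-count at two curves).  `π : X → Spec S` a resolution of a two-dimensional normal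
Noetherian local domain with a RATIONAL singularity, `E_a ≠ E_b` integral exceptional curves (`η_a ≠ η_b` in
`excCurvePoints π`), `z` a common point, `r_z = [κ(z) : κ(𝔪)]`.  By F-97 d) `(E_b·E_a) = h⁰(E_a) + h⁰(E_b) −
h⁰(𝒪_{E_a ∪ E_b})`, by LEMMA H (o5 p562340) `h⁰(E_a), h⁰(E_b) ≤ r_z`, and `h⁰(𝒪_{E_a ∪ E_b}) ≥ 1` (stub-3's
`one_le_h0_prod`): `(E_b·E_a) ≤ 2 r_z − 1`.  On the other hand `(E_b·E_a) = Σ_y ord_y(E_b|_{E_a}) · r_y ≥ Σ_{z common}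
r_z` with every common point contributing `ord ≥ 1` (the (o-H2) computation of p563011, here with two points /
with the multiplicity kept).  Hence:
* (T1) `eq_of_specializes_of_specializes` — two DISTINCT common points `z₁ ≠ z₂` are impossible
  (`r₁ + r₂ ≤ 2rᵢ − 1` for both `i`);
* (T2′) `ordAt_pullback_eq_one` — at a common point the local intersection multiplicity is ONE
  (`ord · r_z ≤ 2 r_z − 1`);
* (T3) `isRegularLocalRing_stalk_ofPoint_of_specializes` — the integral curve `E_a` is REGULAR at `z`: its local
  ring `𝒪_{E_a,z}` is a one-dimensional Noetherian local domain in which the local equation of `E_b` has order one,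
  i.e. generates the maximal ideal (length-one quotient), so it is a discrete valuation ring.

§1 is the fact-free intersection-number layer (any `T`-scheme as in `…NoZenoExcDegreeOnePoint`, universe-polymorphic);
§2 the rational-singularity consequences (universe `0`, the currency of LEMMA H).

References: J. Lipman, *Rational singularities …*, Publ. Math. IHÉS 36 (1969), §10 (p. 212), Prop. (13.1) (p. 223),
Lemma (22.4) (p. 250) [`Lipman1969`]; W. Fulton, *Intersection Theory* (1998), Def. 1.4 [`Fulton1998`].
-/

noncomputable section

-- single-problem summit: the doubled namespace component `ResolutionOfSingularities` is forced
set_option linter.dupNamespace false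

namespace Summit.ResolutionOfSingularities.ResolutionOfSingularities.Theorems.NoZeno.ExcCount

open CategoryTheory AlgebraicGeometry TopologicalSpace IsLocalRing
open Literature.AlgebraicGeometry.Resolution Literature.AlgebraicGeometry.Motives
open Literature.AlgebraicGeometry.Motives.RatFn

universe u

/-! ## §1 The intersection number dominates the terms at common points (fact-free) -/

section Terms

variable {T : Type u} [CommRing T] [IsLocalRing T] {X : Scheme.{u}} [IsIntegral X]
  [IsLocallyNoetherian X] (π : X ⟶ Spec (.of T)) [IsProper π]

/-- **The restricted divisor `[E_{η′}]|_{E_η}` and its honest pull-back.**  For `η′ ̸⤳ η` the divisor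
`[E_{η′}]` avoids the generic point of `E_η`, so `excCurveDegree π [E_{η′}] η` is the `κ(𝔪)`-degree of the
EFFECTIVE pull-back `[E_{η′}].pullbackAvoiding E_η.ι`, a finite sum of non-negative terms
`ord_y · [κ(y) : κ(𝔪)]`; this lemma packages that sum. [cite: Fulton1998, Definition 1.4] -/
theorem excCurveDegree_eq_sum_pullbackAvoiding {η η' : X} (hF : IsEffectiveCartier (primeDivisorIdeal η'))
    (q : (ClosedSubvariety.ofPoint X η).carrier ⟶ Spec (.of (ResidueField T)))
    (hq : q ≫ Spec.map (CommRingCat.ofHom (residue T)) = (ClosedSubvariety.ofPoint X η).ι ≫ π)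
    (hav : (CartierDivisor.ofIsEffectiveCartier (primeDivisorIdeal η') hF).Avoids
      ((ClosedSubvariety.ofPoint X η).ι (genericPoint (ClosedSubvariety.ofPoint X η).carrier))) :
    haveI : IsIntegral (Over.mk q : SchemeOver (ResidueField T)).left :=
      inferInstanceAs (IsIntegral (ClosedSubvariety.ofPoint X η).carrier)
    haveI : IsProper (Over.mk q : SchemeOver (ResidueField T)).hom := isProper_of_fac_specResidueField π hq
    ∃ hfin : (Function.support fun z : ↥(Over.mk q : SchemeOver (ResidueField T)).left =>
        (CartierDivisor.pullbackAvoiding (Y := (Over.mk q : SchemeOver (ResidueField T)).left)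
          (CartierDivisor.ofIsEffectiveCartier (primeDivisorIdeal η') hF)
          (ClosedSubvariety.ofPoint X η).ι hav).ordAt z *
        ((toSpecOver (Over.mk q : SchemeOver (ResidueField T))).left.residueDegree z : ℤ)).Finite,
      excCurveDegree π (CartierDivisor.ofIsEffectiveCartier (primeDivisorIdeal η') hF) η =
        ∑ z ∈ hfin.toFinset, (CartierDivisor.pullbackAvoiding (Y := (Over.mk q : SchemeOver (ResidueField T)).left)
          (CartierDivisor.ofIsEffectiveCartier (primeDivisorIdeal η') hF)
          (ClosedSubvariety.ofPoint X η).ι hav).ordAt z *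
          ((toSpecOver (Over.mk q : SchemeOver (ResidueField T))).left.residueDegree z : ℤ) := by
  haveI : IsIntegral (Over.mk q : SchemeOver (ResidueField T)).left :=
    inferInstanceAs (IsIntegral (ClosedSubvariety.ofPoint X η).carrier)
  haveI : IsProper (Over.mk q : SchemeOver (ResidueField T)).hom := isProper_of_fac_specResidueField π hq
  set D' : CartierDivisor (Over.mk q : SchemeOver (ResidueField T)).left :=
    CartierDivisor.pullbackAvoiding (Y := (Over.mk q : SchemeOver (ResidueField T)).left)
      (CartierDivisor.ofIsEffectiveCartier (primeDivisorIdeal η') hF) (ClosedSubvariety.ofPoint X η).ι hav with hD'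
  have hfin : (Function.support fun z : ↥(Over.mk q : SchemeOver (ResidueField T)).left =>
      D'.ordAt z * ((toSpecOver (Over.mk q : SchemeOver (ResidueField T))).left.residueDegree z : ℤ)).Finite :=
    (CartierDivisor.finite_support_cycle _).subset (Function.support_mul_subset_left _ _)
  refine ⟨hfin, ?_⟩
  have key : excCurveDegree π (CartierDivisor.ofIsEffectiveCartier (primeDivisorIdeal η') hF) η =
      CartierDivisor.degree (Over.mk q : SchemeOver (ResidueField T)) D' := by
    rw [excCurveDegree_eq_degree_of_fac π hq]
    congr 1
    exact CartierDivisor.pullbackRep_of_avoids _ _ hav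
  rw [key, CartierDivisor.degree_eq_finsum, finsum_eq_sum _ hfin]

omit [IsLocallyNoetherian X] in
/-- The divisor `[E_{η′}]` avoids the generic point of `E_η` when `η′ ̸⤳ η`. [folklore] -/
theorem avoids_ι_genericPoint_ofPoint {η η' : X} (hη' : ¬ η' ⤳ η) (hF : IsEffectiveCartier (primeDivisorIdeal η')) :
    (CartierDivisor.ofIsEffectiveCartier (primeDivisorIdeal η') hF).Avoids
      ((ClosedSubvariety.ofPoint X η).ι (genericPoint (ClosedSubvariety.ofPoint X η).carrier)) := by
  have hgen := ClosedSubvariety.genericPoint_ofPoint (X := X) η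
  unfold ClosedSubvariety.genericPoint at hgen
  rw [hgen]
  exact (CartierDivisor.avoids_ofIsEffectiveCartier_iff _ hF η).mpr (by rwa [mem_support_primeDivisorIdeal_iff])

/-- **At a common point the term is at least `ord · [κ : κ(𝔪)]` with `ord ≥ 1`**: for `η ⤳ x`, `η′ ⤳ x`,
`η′ ̸⤳ η`, the pulled-back divisor has order `≥ 1` at the point of `E_η` over `x` (its local equation is not a
unit there). [cite: Fulton1998, Definition 1.4] -/
theorem one_le_ordAt_pullbackAvoiding {η η' x : X} (hη : η ∈ excCurvePoints π) (hη' : ¬ η' ⤳ η)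
    (hx : η ⤳ x) (hx' : η' ⤳ x) (hF : IsEffectiveCartier (primeDivisorIdeal η'))
    (q : (ClosedSubvariety.ofPoint X η).carrier ⟶ Spec (.of (ResidueField T)))
    (hq : q ≫ Spec.map (CommRingCat.ofHom (residue T)) = (ClosedSubvariety.ofPoint X η).ι ≫ π) :
    1 ≤ ((CartierDivisor.ofIsEffectiveCartier (primeDivisorIdeal η') hF).pullbackAvoiding
      (ClosedSubvariety.ofPoint X η).ι (avoids_ι_genericPoint_ofPoint hη' hF)).ordAt (ClosedSubvariety.ofPointPt η hx) := by
  haveI : IsIntegral (Over.mk q : SchemeOver (ResidueField T)).left :=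
    inferInstanceAs (IsIntegral (ClosedSubvariety.ofPoint X η).carrier)
  haveI : IsProper (Over.mk q : SchemeOver (ResidueField T)).hom := isProper_of_fac_specResidueField π hq
  set hav := avoids_ι_genericPoint_ofPoint (X := X) (η := η) hη' hF
  have hDeff : (CartierDivisor.ofIsEffectiveCartier (primeDivisorIdeal η') hF).IsEffective :=
    CartierDivisor.isEffective_ofIsEffectiveCartier _ hF
  have hD'eff := hDeff.pullbackAvoiding (ClosedSubvariety.ofPoint X η).ι hav
  have hDx : ¬ (CartierDivisor.ofIsEffectiveCartier (primeDivisorIdeal η') hF).Avoids x := fun h =>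
    (CartierDivisor.avoids_ofIsEffectiveCartier_iff _ hF x).mp h ((mem_support_primeDivisorIdeal_iff η' x).mpr hx')
  have hxη : x ≠ η := by
    rintro rfl
    exact hη' hx'
  have hcoh : Order.coheight (ClosedSubvariety.ofPointPt η hx) = 1 :=
    CartierDivisor.coheight_eq_one_of_height_eq_zero (C := (Over.mk q : SchemeOver (ResidueField T)))
      (height_top_ofPoint_eq_one π hη) (height_ofPointPt_eq_zero π hη hx hxη)
  obtain ⟨i, hi⟩ := ((CartierDivisor.ofIsEffectiveCartier (primeDivisorIdeal η') hF).pullbackAvoiding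
    (ClosedSubvariety.ofPoint X η).ι hav).covers (ClosedSubvariety.ofPointPt η hx)
  have hi' : (ClosedSubvariety.ofPoint X η).ι (ClosedSubvariety.ofPointPt η hx) ∈
      (CartierDivisor.ofIsEffectiveCartier (primeDivisorIdeal η') hF).U i.1 := hi
  have hu : ¬ IsUnitAt ((ClosedSubvariety.ofPoint X η).ι (ClosedSubvariety.ofPointPt η hx))
      ((CartierDivisor.ofIsEffectiveCartier (primeDivisorIdeal η') hF).f i.1) :=
    fun h => hDx (CartierDivisor.Avoids.of_mem hi' h)
  have hu' := hDeff.not_isUnitAt_pullbackAvoiding (ClosedSubvariety.ofPoint X η).ι hav i hi hu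
  have hpos := hD'eff.ordAt_pos hi hu' hcoh
  omega

/-- **Two common points: `[κ(x₁) : κ(𝔪)] + [κ(x₂) : κ(𝔪)] ≤ (E_{η′} · E_η)`** for `x₁ ≠ x₂` both specialisations of
`η` and of `η′` (`η′ ̸⤳ η`). [cite: Lipman1969, Section 13 (p. 223); Fulton1998, Definition 1.4] -/
theorem residueDegree_add_le_excCurveDegree {η η' x₁ x₂ : X} (hη : η ∈ excCurvePoints π) (hη' : ¬ η' ⤳ η)
    (hx₁ : η ⤳ x₁) (hx₁' : η' ⤳ x₁) (hx₂ : η ⤳ x₂) (hx₂' : η' ⤳ x₂) (hne : x₁ ≠ x₂)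
    (hF : IsEffectiveCartier (primeDivisorIdeal η')) :
    ((π.residueDegree x₁ : ℕ) : ℤ) + ((π.residueDegree x₂ : ℕ) : ℤ) ≤
      excCurveDegree π (CartierDivisor.ofIsEffectiveCartier (primeDivisorIdeal η') hF) η := by
  classical
  obtain ⟨q, hq⟩ := exists_fac_specResidueField π hη.1
  haveI : IsIntegral (Over.mk q : SchemeOver (ResidueField T)).left :=
    inferInstanceAs (IsIntegral (ClosedSubvariety.ofPoint X η).carrier)
  haveI : IsProper (Over.mk q : SchemeOver (ResidueField T)).hom := isProper_of_fac_specResidueField π hq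
  set hav := avoids_ι_genericPoint_ofPoint (X := X) (η := η) hη' hF
  obtain ⟨hfin, hsum⟩ := excCurveDegree_eq_sum_pullbackAvoiding π hF q hq hav
  set D' : CartierDivisor (Over.mk q : SchemeOver (ResidueField T)).left :=
    CartierDivisor.pullbackAvoiding (Y := (Over.mk q : SchemeOver (ResidueField T)).left)
      (CartierDivisor.ofIsEffectiveCartier (primeDivisorIdeal η') hF) (ClosedSubvariety.ofPoint X η).ι hav with hD'
  have hD'eff : D'.IsEffective :=
    (CartierDivisor.isEffective_ofIsEffectiveCartier _ hF).pullbackAvoiding (ClosedSubvariety.ofPoint X η).ι hav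
  -- the two points of `E_η`
  set y₁ : ↥(Over.mk q : SchemeOver (ResidueField T)).left := ClosedSubvariety.ofPointPt η hx₁ with hy₁
  set y₂ : ↥(Over.mk q : SchemeOver (ResidueField T)).left := ClosedSubvariety.ofPointPt η hx₂ with hy₂
  have hyne : y₁ ≠ y₂ := fun h => hne (congrArg (fun y => (ClosedSubvariety.ofPoint X η).ι y) h)
  -- residue degrees in the two currencies
  have hr₁ : ((toSpecOver (Over.mk q : SchemeOver (ResidueField T))).left.residueDegree y₁ : ℤ) =
      π.residueDegree x₁ := by
    rw [← residueDegree_ι_comp_ofPointPt π hx₁, residueDegree_ι_comp_eq_of_fac π hq]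
    rfl
  have hr₂ : ((toSpecOver (Over.mk q : SchemeOver (ResidueField T))).left.residueDegree y₂ : ℤ) =
      π.residueDegree x₂ := by
    rw [← residueDegree_ι_comp_ofPointPt π hx₂, residueDegree_ι_comp_eq_of_fac π hq]
    rfl
  have hr₁pos : (0 : ℤ) < π.residueDegree x₁ := by
    have h := residueDegree_ofPointPt_pos π hη hx₁ (by rintro rfl; exact hη' hx₁')
    rw [residueDegree_ι_comp_ofPointPt π hx₁] at h
    exact_mod_cast h
  have hr₂pos : (0 : ℤ) < π.residueDegree x₂ := by
    have h := residueDegree_ofPointPt_pos π hη hx₂ (by rintro rfl; exact hη' hx₂')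
    rw [residueDegree_ι_comp_ofPointPt π hx₂] at h
    exact_mod_cast h
  have ho₁ : 1 ≤ D'.ordAt y₁ := one_le_ordAt_pullbackAvoiding π hη hη' hx₁ hx₁' hF q hq
  have ho₂ : 1 ≤ D'.ordAt y₂ := one_le_ordAt_pullbackAvoiding π hη hη' hx₂ hx₂' hF q hq
  -- each of the two terms is at least the residue degree
  have ht₁ : (π.residueDegree x₁ : ℤ) ≤ D'.ordAt y₁ *
      ((toSpecOver (Over.mk q : SchemeOver (ResidueField T))).left.residueDegree y₁ : ℤ) := by
    rw [hr₁]; exact le_mul_of_one_le_left hr₁pos.le ho₁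
  have ht₂ : (π.residueDegree x₂ : ℤ) ≤ D'.ordAt y₂ *
      ((toSpecOver (Over.mk q : SchemeOver (ResidueField T))).left.residueDegree y₂ : ℤ) := by
    rw [hr₂]; exact le_mul_of_one_le_left hr₂pos.le ho₂
  have hmem₁ : y₁ ∈ hfin.toFinset :=
    hfin.mem_toFinset.mpr (Function.mem_support.mpr (lt_of_lt_of_le hr₁pos ht₁).ne')
  have hmem₂ : y₂ ∈ hfin.toFinset :=
    hfin.mem_toFinset.mpr (Function.mem_support.mpr (lt_of_lt_of_le hr₂pos ht₂).ne')
  have hsub : ({y₁, y₂} : Finset _) ⊆ hfin.toFinset := by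
    intro y hy
    rcases Finset.mem_insert.mp hy with rfl | hy
    · exact hmem₁
    · rw [Finset.mem_singleton.mp hy]; exact hmem₂
  rw [hsum]
  calc ((π.residueDegree x₁ : ℕ) : ℤ) + ((π.residueDegree x₂ : ℕ) : ℤ)
      ≤ D'.ordAt y₁ * ((toSpecOver (Over.mk q : SchemeOver (ResidueField T))).left.residueDegree y₁ : ℤ) +
        D'.ordAt y₂ * ((toSpecOver (Over.mk q : SchemeOver (ResidueField T))).left.residueDegree y₂ : ℤ) :=
        add_le_add ht₁ ht₂
    _ = ∑ z ∈ ({y₁, y₂} : Finset _), D'.ordAt z *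
        ((toSpecOver (Over.mk q : SchemeOver (ResidueField T))).left.residueDegree z : ℤ) :=
        (Finset.sum_pair (f := fun z => D'.ordAt z *
          ((toSpecOver (Over.mk q : SchemeOver (ResidueField T))).left.residueDegree z : ℤ)) hyne).symm
    _ ≤ ∑ z ∈ hfin.toFinset, D'.ordAt z *
        ((toSpecOver (Over.mk q : SchemeOver (ResidueField T))).left.residueDegree z : ℤ) :=
        Finset.sum_le_sum_of_subset_of_nonneg hsub fun z _ _ =>
          mul_nonneg (hD'eff.ordAt_nonneg z) (Nat.cast_nonneg _)

/-- **One common point, multiplicity kept: `ord_y · [κ(x) : κ(𝔪)] ≤ (E_{η′} · E_η)`** (`y` the point of `E_η`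
over `x`). [cite: Fulton1998, Definition 1.4] -/
theorem ordAt_mul_residueDegree_le_excCurveDegree {η η' x : X} (hη : η ∈ excCurvePoints π) (hη' : ¬ η' ⤳ η)
    (hx : η ⤳ x) (hF : IsEffectiveCartier (primeDivisorIdeal η')) :
    ((CartierDivisor.ofIsEffectiveCartier (primeDivisorIdeal η') hF).pullbackAvoiding
        (ClosedSubvariety.ofPoint X η).ι (avoids_ι_genericPoint_ofPoint hη' hF)).ordAt
        (ClosedSubvariety.ofPointPt η hx) * ((π.residueDegree x : ℕ) : ℤ) ≤
      excCurveDegree π (CartierDivisor.ofIsEffectiveCartier (primeDivisorIdeal η') hF) η := by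
  obtain ⟨q, hq⟩ := exists_fac_specResidueField π hη.1
  haveI : IsIntegral (Over.mk q : SchemeOver (ResidueField T)).left :=
    inferInstanceAs (IsIntegral (ClosedSubvariety.ofPoint X η).carrier)
  haveI : IsProper (Over.mk q : SchemeOver (ResidueField T)).hom := isProper_of_fac_specResidueField π hq
  set hav := avoids_ι_genericPoint_ofPoint (X := X) (η := η) hη' hF
  obtain ⟨hfin, hsum⟩ := excCurveDegree_eq_sum_pullbackAvoiding π hF q hq hav
  set D' : CartierDivisor (Over.mk q : SchemeOver (ResidueField T)).left :=
    CartierDivisor.pullbackAvoiding (Y := (Over.mk q : SchemeOver (ResidueField T)).left)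
      (CartierDivisor.ofIsEffectiveCartier (primeDivisorIdeal η') hF) (ClosedSubvariety.ofPoint X η).ι hav with hD'
  have hD'eff : D'.IsEffective :=
    (CartierDivisor.isEffective_ofIsEffectiveCartier _ hF).pullbackAvoiding (ClosedSubvariety.ofPoint X η).ι hav
  set y : ↥(Over.mk q : SchemeOver (ResidueField T)).left := ClosedSubvariety.ofPointPt η hx with hy
  have hr : ((toSpecOver (Over.mk q : SchemeOver (ResidueField T))).left.residueDegree y : ℤ) =
      π.residueDegree x := by
    rw [← residueDegree_ι_comp_ofPointPt π hx, residueDegree_ι_comp_eq_of_fac π hq]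
    rfl
  rw [hsum, ← hr]
  show D'.ordAt y * ((toSpecOver (Over.mk q : SchemeOver (ResidueField T))).left.residueDegree y : ℤ) ≤
    ∑ z ∈ hfin.toFinset, D'.ordAt z * ((toSpecOver (Over.mk q : SchemeOver (ResidueField T))).left.residueDegree z : ℤ)
  by_cases hmem : y ∈ hfin.toFinset
  · exact Finset.single_le_sum (fun z _ => mul_nonneg (hD'eff.ordAt_nonneg z) (Nat.cast_nonneg _)) hmem
  · have h0 : D'.ordAt y * ((toSpecOver (Over.mk q : SchemeOver (ResidueField T))).left.residueDegree y : ℤ) = 0 := by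
      by_contra h
      exact hmem (hfin.mem_toFinset.mpr (Function.mem_support.mpr h))
    rw [h0]
    exact Finset.sum_nonneg fun z _ => mul_nonneg (hD'eff.ordAt_nonneg z) (Nat.cast_nonneg _)

end Terms

/-! ## §2 Over a rational singularity: at most one common point, multiplicity one, regularity -/

section Rational

variable {S : Type} [CommRing S] [IsNoetherianRing S] [IsLocalRing S] [IsDomain S] [IsIntegrallyClosed S]
  {X : Scheme.{0}} [IsIntegral X] [IsLocallyNoetherian X] {π : X ⟶ Spec (.of S)}

/-- **The upper bound `(E_b · E_a) ≤ 2·[κ(z) : κ(𝔪)] − 1` at a common point `z`** of two distinct integral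
exceptional curves of a resolution of a RATIONAL two-dimensional normal local domain: F-97 d)
`(E_b·E_a) = h⁰(E_a) + h⁰(E_b) − h⁰(𝒪_{E_a ∪ E_b})`, LEMMA H `h⁰(E_a), h⁰(E_b) ≤ [κ(z) : κ(𝔪)]` and
`h⁰(𝒪_{E_a ∪ E_b}) ≥ 1`.  Conditional on `Lipman1969_13_1_d_rat`.
[cite: Lipman1969, Proposition (13.1) d) (p. 223) and Section 10 (p. 212)] -/
theorem excCurveDegree_le_two_mul_residueDegree_sub_one (h131d : Lipman1969_13_1_d_rat.{0})
    (hdim : ringKrullDim S = 2) (hS : HasRationalSingularity S) (hπ : IsResolution π)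
    {η_a η_b : X} (ha : η_a ∈ excCurvePoints π) (hb : η_b ∈ excCurvePoints π) (hne : η_a ≠ η_b)
    {z : X} (hza : η_a ⤳ z) (hzb : η_b ⤳ z) (hF : IsEffectiveCartier (primeDivisorIdeal η_b)) :
    excCurveDegree π (CartierDivisor.ofIsEffectiveCartier (primeDivisorIdeal η_b) hF) η_a ≤
      2 * ((π.residueDegree z : ℕ) : ℤ) - 1 := by
  haveI : IsProper π := hπ.isProper
  have hba : ¬ η_b ⤳ η_a := not_specializes_of_mem_excCurvePoints_of_ne π ha hb hne
  have hab : ¬ η_a ⤳ η_b := not_specializes_of_mem_excCurvePoints_of_ne π hb ha hne.symm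
  have hz_a : z ≠ η_a := by rintro rfl; exact hba hzb
  have hz_b : z ≠ η_b := by rintro rfl; exact hab hza
  rw [h131d S hdim hS X π hπ η_a ha η_b hb hF]
  have h1 := h0_primeDivisorIdeal_toNat_le_residueDegree_base π ha hza hz_a
  have h2 := h0_primeDivisorIdeal_toNat_le_residueDegree_base π hb hzb hz_b
  have h3 : (1 : ℤ) ≤ ((h0 π (primeDivisorIdeal η_b * primeDivisorIdeal η_a)).toNat : ℤ) := by
    have h := one_le_h0_prod π ({η_b, η_a} : Multiset X) (by simp) (by
      intro η hη
      simp only [Multiset.mem_cons, Multiset.mem_singleton, Multiset.insert_eq_cons] at hη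
      rcases hη with rfl | rfl
      · exact hb
      · exact ha)
    simpa using h
  omega

/-- **(T1) TWO DISTINCT EXCEPTIONAL CURVES OF A RATIONAL RESOLUTION MEET IN AT MOST ONE POINT.**  For `π` a resolution of
a RATIONAL two-dimensional normal Noetherian local domain, `η_a ≠ η_b` in `excCurvePoints π`, and `z₁`, `z₂` points lying
on both `E_a = closure {η_a}` and `E_b`: `z₁ = z₂`.  Conditional on `Lipman1969_13_1_d_rat`.
[cite: Lipman1969, Proposition (13.1) d) (p. 223) and Lemma (22.4) (p. 250)] -/
theorem eq_of_specializes_of_specializes (h131d : Lipman1969_13_1_d_rat.{0})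
    (hdim : ringKrullDim S = 2) (hS : HasRationalSingularity S) (hπ : IsResolution π)
    {η_a η_b : X} (ha : η_a ∈ excCurvePoints π) (hb : η_b ∈ excCurvePoints π) (hne : η_a ≠ η_b)
    {z₁ z₂ : X} (h₁a : η_a ⤳ z₁) (h₁b : η_b ⤳ z₁) (h₂a : η_a ⤳ z₂) (h₂b : η_b ⤳ z₂) : z₁ = z₂ := by
  haveI : IsProper π := hπ.isProper
  by_contra hz
  have hF : IsEffectiveCartier (primeDivisorIdeal η_b) := isEffectiveCartier_primeDivisorIdeal_of_isRegular
    hπ.isRegular (IsResolution.coheight_eq_one_of_mem_excCurvePoints hdim hπ hb)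
  have hba : ¬ η_b ⤳ η_a := not_specializes_of_mem_excCurvePoints_of_ne π ha hb hne
  have hsum := residueDegree_add_le_excCurveDegree π ha hba h₁a h₁b h₂a h₂b hz hF
  have hu₁ := excCurveDegree_le_two_mul_residueDegree_sub_one h131d hdim hS hπ ha hb hne h₁a h₁b hF
  have hu₂ := excCurveDegree_le_two_mul_residueDegree_sub_one h131d hdim hS hπ ha hb hne h₂a h₂b hF
  omega

/-- (T1), closure form: `closure {η_a} ∩ closure {η_b}` has at most one point. [cite: Lipman1969, Proposition (13.1) d) (p. 223)] -/
theorem subsingleton_closure_inter_closure (h131d : Lipman1969_13_1_d_rat.{0})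
    (hdim : ringKrullDim S = 2) (hS : HasRationalSingularity S) (hπ : IsResolution π)
    {η_a η_b : X} (ha : η_a ∈ excCurvePoints π) (hb : η_b ∈ excCurvePoints π) (hne : η_a ≠ η_b) :
    (closure {η_a} ∩ closure ({η_b} : Set X)).Subsingleton := fun _ h₁ _ h₂ =>
  eq_of_specializes_of_specializes h131d hdim hS hπ ha hb hne
    (specializes_iff_mem_closure.mpr h₁.1) (specializes_iff_mem_closure.mpr h₁.2)
    (specializes_iff_mem_closure.mpr h₂.1) (specializes_iff_mem_closure.mpr h₂.2)

/-- **(T2′) THE LOCAL INTERSECTION MULTIPLICITY AT A COMMON POINT IS ONE**: with the data of (T1) and a common point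
`z`, the order at the point of `E_a` over `z` of the restricted divisor `[E_b]|_{E_a}` (honest pull-back) is `1`.
Conditional on `Lipman1969_13_1_d_rat`. [cite: Lipman1969, Proposition (13.1) d) (p. 223)] -/
theorem ordAt_pullbackAvoiding_eq_one (h131d : Lipman1969_13_1_d_rat.{0})
    (hdim : ringKrullDim S = 2) (hS : HasRationalSingularity S) (hπ : IsResolution π)
    {η_a η_b : X} (ha : η_a ∈ excCurvePoints π) (hb : η_b ∈ excCurvePoints π) (hne : η_a ≠ η_b)
    {z : X} (hza : η_a ⤳ z) (hzb : η_b ⤳ z) (hF : IsEffectiveCartier (primeDivisorIdeal η_b)) :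
    haveI : IsProper π := hπ.isProper
    ((CartierDivisor.ofIsEffectiveCartier (primeDivisorIdeal η_b) hF).pullbackAvoiding
        (ClosedSubvariety.ofPoint X η_a).ι
        (avoids_ι_genericPoint_ofPoint (not_specializes_of_mem_excCurvePoints_of_ne π ha hb hne) hF)).ordAt
      (ClosedSubvariety.ofPointPt η_a hza) = 1 := by
  haveI : IsProper π := hπ.isProper
  have hba : ¬ η_b ⤳ η_a := not_specializes_of_mem_excCurvePoints_of_ne π ha hb hne
  obtain ⟨q, hq⟩ := exists_fac_specResidueField π ha.1
  have ho := one_le_ordAt_pullbackAvoiding π ha hba hza hzb hF q hq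
  have hle := ordAt_mul_residueDegree_le_excCurveDegree π ha hba hza hF
  have hu := excCurveDegree_le_two_mul_residueDegree_sub_one h131d hdim hS hπ ha hb hne hza hzb hF
  have hrpos : (0 : ℤ) < π.residueDegree z := by
    have h := residueDegree_ofPointPt_pos π ha hza (by rintro rfl; exact hba hzb)
    rw [residueDegree_ι_comp_ofPointPt π hza] at h
    exact_mod_cast h
  nlinarith

end Rational

end Summit.ResolutionOfSingularities.ResolutionOfSingularities.Theorems.NoZeno.ExcCount

end
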